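import Literature.NumberTheory.Transcendental.ZetaLinearFormsCriterion
import Mathlib.RingTheory.PowerSeries.Basic
import Mathlib.NumberTheory.Chebyshev
import Mathlib.Tactic
import HarnessLib

/-!
# The basic arithmetic holonomy bound, IV-b: denominator types

Calegari–Dimitrov–Tang, arXiv:2408.15403, §2.2 / Appendix §17: the functions entering the
holonomy bounds have *denominator types*
`f(x) = Σₙ aₙ xⁿ / ([1,…,b₁n] ⋯ [1,…,b_r n])`, `aₙ ∈ ℤ` (eq. (gen den form)), where
`[1,…,N] = lcm(1,…,N)`; in the dynamic box principle (§17.2) this is used in the form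
"all such rational numbers `β` belong to `(1/([1,…,b₁u(p)]⋯[1,…,b_r u(p)])) ℤ`", and the
denominators grow like `e^{(b₁+⋯+b_r) u(p) + o(u(p))}` by the prime number theorem.

## Contents (all proved; no named facts)

* `HolonomyBound.den b n = Π_j lcm(1,…,b_j n)`, `den_pos`, `den_dvd_den` (monotone in `n`).
* `HolonomyBound.exists_int_coeff_eq_div_den` — integrality: for integer `a`, `c`, the `N`-th
  coefficient of `Σᵢ Σⱼ c i j • (X^j · fᵢ)` with `fᵢ = Σ_k (a i k / den b k) x^k` lies in
  `(1/den b N) ℤ`.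
* `HolonomyBound.exists_den_le_exp` — growth: for every `ε > 0` there is `C ≥ 1` with
  `den b n ≤ C · exp((Σ b_j + ε) n)` for *all* `n` (from the tree's
  `eventually_lcmUpto_mul_le_exp`, i.e. the prime number theorem).

## References

* [CalegariDimitrovTang2024] arXiv:2408.15403, §2.2 eq. (integrality); Appendix §17.2
  (denominators of `β_{u(p)}`), p. 130.
-/

noncomputable section

open Filter Finset PowerSeries

namespace Literature.NumberTheory.Transcendental

namespace HolonomyBound

variable {r : ℕ}

/-! ### The denominator type `[1,…,b₁n]⋯[1,…,b_r n]` -/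

/-- The denominator of index `n` of the type `(b₁, …, b_r)`: `Π_j lcm(1, …, b_j n)`.
[cite: CalegariDimitrovTang2024, §2.2 eq. (integrality) / Appendix §17.1 eq. (gen den form)] -/
def den (b : Fin r → ℕ) (n : ℕ) : ℕ :=
  ∏ j : Fin r, Nat.lcmUpto (b j * n)

/-- Denominators are positive. [folklore] -/
theorem den_pos (b : Fin r → ℕ) (n : ℕ) : 0 < den b n :=
  Finset.prod_pos fun _ _ => Nat.lcmUpto_pos _

/-- The denominators are monotone for divisibility: `den b k ∣ den b n` for `k ≤ n`
(`lcm(1,…,N) ∣ lcm(1,…,N')` for `N ≤ N'`, cf. the tree's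
`Literature.NumberTheory.LFunctions.lcmUpto_dvd_lcmUpto_of_le`). [folklore] -/
theorem den_dvd_den (b : Fin r → ℕ) {k n : ℕ} (h : k ≤ n) : den b k ∣ den b n :=
  Finset.prod_dvd_prod_of_dvd _ _ fun _ _ => by
    unfold Nat.lcmUpto
    exact Finset.lcm_mono (Finset.Icc_subset_Icc_right (Nat.mul_le_mul_left _ h))

/-! ### Integrality of the coefficients of `Σ Qᵢ fᵢ` -/

/-- **Denominators of the output coefficients** (CDT §17.2: "all such rational numbers `β`
belong in fact to `(1/[1,…,b₁u(p)]⋯[1,…,b_r u(p)]) ℤ`"): for integers `a i k` and `c i j`, the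
`N`-th coefficient of `Σᵢ Σ_{j<D} c i j • (X^j · fᵢ)`, `fᵢ = Σ_k (a i k / den b k) x^k`, is an
integer divided by `den b N`. [cite: CalegariDimitrovTang2024, Appendix §17.2 (p. 130)] -/
theorem exists_int_coeff_eq_div_den {m D : ℕ} (b : Fin r → ℕ) (a : Fin m → ℕ → ℤ)
    (c : Fin m → Fin D → ℤ) (N : ℕ) :
    ∃ z : ℤ, coeff N (∑ i : Fin m, ∑ j : Fin D, ((c i j : ℤ) : ℚ) •
        ((X : PowerSeries ℚ) ^ (j : ℕ) * PowerSeries.mk fun k => (a i k : ℚ) / den b k)) =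
      (z : ℚ) / den b N := by
  classical
  -- the integer numerators, using `den b (N - j) ∣ den b N`
  refine ⟨∑ i : Fin m, ∑ j : Fin D, if (j : ℕ) ≤ N then
      c i j * a i (N - j) * ((den b N : ℤ) / (den b (N - j) : ℤ)) else 0, ?_⟩
  have hdN : (den b N : ℚ) ≠ 0 := by exact_mod_cast (den_pos b N).ne'
  rw [eq_div_iff hdN]
  simp only [map_sum, map_smul, coeff_X_pow_mul', coeff_mk, smul_eq_mul]
  push_cast
  rw [Finset.sum_mul]
  refine Finset.sum_congr rfl fun i _ => ?_
  rw [Finset.sum_mul]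
  refine Finset.sum_congr rfl fun j _ => ?_
  split_ifs with h
  · have hdvd : den b (N - j) ∣ den b N := den_dvd_den b (Nat.sub_le N j)
    have hdvd' : (den b (N - j) : ℤ) ∣ (den b N : ℤ) := Int.natCast_dvd_natCast.mpr hdvd
    have hd0 : (den b (N - j) : ℚ) ≠ 0 := by exact_mod_cast (den_pos b (N - j)).ne'
    have hd0' : ((den b (N - j) : ℤ) : ℚ) ≠ 0 := by exact_mod_cast (den_pos b (N - j)).ne'
    rw [Int.cast_div hdvd' hd0']
    push_cast
    field_simp
  · simp

/-! ### Growth of the denominators (prime number theorem) -/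

/-- **Growth of the denominator type**: for every `ε > 0` there is a constant `C ≥ 1` with
`den b n ≤ C · exp((Σ_j b_j + ε) · n)` for all `n` — the prime number theorem in the form
`[1,…,N] = e^{N + o(N)}` (tree: `eventually_lcmUpto_mul_le_exp`), made uniform in `n`.
[cite: CalegariDimitrovTang2024, §2.2 (rate `τ = bσ` of a denominator type); Appendix §17.2
eq. for `γ_p` (p. 130)] -/
theorem exists_den_le_exp (b : Fin r → ℕ) {ε : ℝ} (hε : 0 < ε) :
    ∃ C : ℝ, 1 ≤ C ∧ ∀ n : ℕ,
      (den b n : ℝ) ≤ C * Real.exp ((∑ j, (b j : ℝ) + ε) * n) := by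
  -- eventually, each factor is `≤ exp((b_j + ε/(r+1)) n)`
  have hε' : 0 < ε / (r + 1) := by positivity
  have hev : ∀ᶠ n : ℕ in atTop, (den b n : ℝ) ≤ Real.exp ((∑ j, (b j : ℝ) + ε) * n) := by
    have hall : ∀ᶠ n : ℕ in atTop, ∀ j : Fin r,
        (Nat.lcmUpto (b j * n) : ℝ) ≤ Real.exp ((b j + ε / (r + 1)) * n) :=
      eventually_all.mpr fun j => eventually_lcmUpto_mul_le_exp (b j) hε'
    filter_upwards [hall] with n hn
    unfold den
    push_cast
    calc ∏ j : Fin r, (Nat.lcmUpto (b j * n) : ℝ)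
        ≤ ∏ j : Fin r, Real.exp ((b j + ε / (r + 1)) * n) :=
          Finset.prod_le_prod (fun j _ => by positivity) fun j _ => hn j
      _ = Real.exp (∑ j : Fin r, (b j + ε / (r + 1)) * n) := (Real.exp_sum _ _).symm
      _ ≤ Real.exp ((∑ j, (b j : ℝ) + ε) * n) := by
          apply Real.exp_le_exp.mpr
          rw [← Finset.sum_mul, Finset.sum_add_distrib, Finset.sum_const, Finset.card_univ,
            Fintype.card_fin, nsmul_eq_mul]
          have hn0 : (0 : ℝ) ≤ n := n.cast_nonneg
          have hr : (r : ℝ) * (ε / (r + 1)) ≤ ε := by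
            rw [mul_div_assoc']
            rw [div_le_iff₀ (by positivity)]
            nlinarith
          nlinarith
  -- make it uniform with a constant
  obtain ⟨N₀, hN₀⟩ := eventually_atTop.mp hev
  have hsum0 : 0 ≤ ∑ k ∈ Finset.range N₀, (den b k : ℝ) :=
    Finset.sum_nonneg fun k _ => by positivity
  refine ⟨1 + ∑ k ∈ Finset.range N₀, (den b k : ℝ), by linarith, fun n => ?_⟩
  have hexp1 : 1 ≤ Real.exp ((∑ j, (b j : ℝ) + ε) * n) := Real.one_le_exp (by positivity)
  rcases lt_or_ge n N₀ with hn | hn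
  · have h1 : (den b n : ℝ) ≤ ∑ k ∈ Finset.range N₀, (den b k : ℝ) :=
      Finset.single_le_sum (f := fun k => (den b k : ℝ)) (fun k _ => by positivity)
        (Finset.mem_range.mpr hn)
    calc (den b n : ℝ) ≤ 1 + ∑ k ∈ Finset.range N₀, (den b k : ℝ) := by linarith
      _ = (1 + ∑ k ∈ Finset.range N₀, (den b k : ℝ)) * 1 := (mul_one _).symm
      _ ≤ (1 + ∑ k ∈ Finset.range N₀, (den b k : ℝ)) *
            Real.exp ((∑ j, (b j : ℝ) + ε) * n) :=
          mul_le_mul_of_nonneg_left hexp1 (by linarith)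
  · calc (den b n : ℝ) ≤ Real.exp ((∑ j, (b j : ℝ) + ε) * n) := hN₀ n hn
      _ = 1 * Real.exp ((∑ j, (b j : ℝ) + ε) * n) := (one_mul _).symm
      _ ≤ (1 + ∑ k ∈ Finset.range N₀, (den b k : ℝ)) *
            Real.exp ((∑ j, (b j : ℝ) + ε) * n) :=
          mul_le_mul_of_nonneg_right (by linarith) (by positivity)

end HolonomyBound

end Literature.NumberTheory.Transcendental
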